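import Literature.Probability.RandomPlanarGeometry.SAWBridgeRenewalDensity
import HarnessLib

/-!
# Ballistic bridges are exponentially rare, from DCH Theorem 3.1 and the renewal-density bound (lane K23)

Topic `Literature/Probability/RandomPlanarGeometry` (continues `SAWBridgeRenewalDensity.lean`: `Zd.renewalCount`,
K3⁺ `Zd.renewalDensityExpSmall_of_thm25`).

Source: H. Duminil-Copin, A. Hammond, *Self-avoiding walk is sub-ballistic*, CMP 324 (2013), Theorem 2.3 and the
proof of Corollary 2.4 (arXiv:1205.0401, pp. 6 and 11): under the ballistic assumption `BA(v)` — bridges reach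
height `v n` with probability `≥ e^{-o(n)}` along a subsequence — Theorem 3.1 produces a positive density of
renewal points at subexponential cost, which contradicts the exponential smallness of that density (Corollary
2.4's mechanism, here the lane's node K3⁺). This file proves the CONTRAPOSITIVE COMPOSITION, node K23 of the
lane's «DCH-1.1» programme (a-idea-2 gen 8, `Sketch_v8_DCH11.lean` af0d5d5257412376, `Thm23c_of_thm31`):

  (Thm 3.1 at `d`) ∧ (K3⁺ at `d`) ⟹ `¬ BA(v)` at `d` for every `v > 0`, in the exponential form
  `#{γ ∈ SAB_n : y(γ_n) ≥ v n} ≤ e^{-c n} b_n` for `n ≥ n₀`.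

The hypotheses and the conclusion are the BODIES of the planner's `DCH_thm31` (at `d`), `RenewalDensityExpSmallAt d`
and `BridgeNotBallisticAt d` (so that this file waits on no other seat's definitions; the skeleton's composition
applies it through the `def`s). Proof: diagonal extraction of a subsequence along which bridges are ballistic at
rate `e^{-u_k/(k+1)}`, Theorem 3.1 along it, and the clash `e^{-o(N)} ≤ e^{(ε_n - ε₀) N}`.

Printed status: a step of a PRINTED proof (DCH §2.3–2.4), formalised; no novelty claimed.
[cite: DuminilCopinHammond2013, Theorem 2.3 and Corollary 2.4 (arXiv v1, p. 8; proof of Corollary 2.4 p. 18)]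
-/

noncomputable section

open Finset Filter Topology Literature.Probability.LatticeModels Literature.Probability.Percolation
open scoped BigOperators

namespace Literature.Probability.RandomPlanarGeometry.SAW.Zd

variable {d : ℕ} [NeZero d]

/-- **Diagonal extraction from the ballistic assumption**: if the exponential bound
`#{γ ∈ SAB_n : y(γ_n) ≥ vn} ≤ e^{-cn} b_n (n ≥ n₀)` fails for every `c > 0` and `n₀`, there is a strictly increasing
`u` with `u_k ≥ 1` and `#{γ ∈ SAB_{u_k} : y ≥ v u_k} > e^{-u_k/(k+1)} b_{u_k}` for every `k`.
[cite: DuminilCopinHammond2013, §2.2 (BA(v)) and proof of Corollary 2.4] -/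
theorem exists_strictMono_ballistic_of_not {v : ℝ}
    (hneg : ¬ ∃ c : ℝ, 0 < c ∧ ∃ n₀ : ℕ, ∀ n : ℕ, n₀ ≤ n →
      ((((bridges d n).filter fun ω => v * (n : ℝ) ≤ ((ω n 0 : ℤ) : ℝ)).card : ℝ)) ≤
        Real.exp (-(c * n)) * (bridgeCount d n : ℝ)) :
    ∃ u : ℕ → ℕ, StrictMono u ∧ (∀ k, 1 ≤ u k) ∧ ∀ k : ℕ,
      Real.exp (-(1 / ((k : ℝ) + 1) * (u k : ℝ))) * (bridgeCount d (u k) : ℝ) <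
        (((bridges d (u k)).filter fun ω => v * (u k : ℝ) ≤ ((ω (u k) 0 : ℤ) : ℝ)).card : ℝ) := by
  classical
  have hex : ∀ k n₀ : ℕ, ∃ n : ℕ, n₀ ≤ n ∧
      Real.exp (-(1 / ((k : ℝ) + 1) * (n : ℝ))) * (bridgeCount d n : ℝ) <
        (((bridges d n).filter fun ω => v * (n : ℝ) ≤ ((ω n 0 : ℤ) : ℝ)).card : ℝ) := by
    intro k n₀
    by_contra hall
    apply hneg
    refine ⟨1 / ((k : ℝ) + 1), by positivity, n₀, fun n hn => ?_⟩
    by_contra hlt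
    exact hall ⟨n, hn, lt_of_not_ge hlt⟩
  choose nx hnx_ge hnx_lt using hex
  let u : ℕ → ℕ := fun k => Nat.rec (nx 0 1) (fun k uk => nx (k + 1) (uk + 1)) k
  have hu0 : u 0 = nx 0 1 := rfl
  have huS : ∀ k, u (k + 1) = nx (k + 1) (u k + 1) := fun k => rfl
  have hmono : StrictMono u := strictMono_nat_of_lt_succ fun k => by
    rw [huS]
    have := hnx_ge (k + 1) (u k + 1)
    omega
  have hu1 : ∀ k, 1 ≤ u k := by
    intro k
    induction k with
    | zero => rw [hu0]; exact hnx_ge 0 1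
    | succ k ih => have := hmono (Nat.lt_add_one k); omega
  refine ⟨u, hmono, hu1, fun k => ?_⟩
  cases k with
  | zero => rw [hu0]; simpa using hnx_lt 0 1
  | succ k => rw [huS]; exact hnx_lt (k + 1) (u k + 1)

/-- **K23 (lane «DCH-1.1», a-idea-2 `Thm23c_of_thm31` at one `d`, bodies inlined)**: Theorem 3.1 at `d` and
the exponential smallness of the renewal density at `d` imply that bridges are NOT ballistic at `d`:
for every `v > 0` there are `c > 0`, `n₀` with `#{γ ∈ SAB_n : y(γ_n) ≥ v n} ≤ e^{-cn} b_n` for `n ≥ n₀`.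
[cite: DuminilCopinHammond2013, Theorem 2.3 and proof of Corollary 2.4 (arXiv v1, pp. 8, 18)] -/
theorem bridgeNotBallisticAt_of_thm31_of_renewalDensity
    (h31 : ∀ v : ℝ, 0 < v → ∀ u : ℕ → ℕ, StrictMono u →
      ∃ δ : ℝ, 0 < δ ∧ ∃ φ : ℕ → ℕ, StrictMono φ ∧ ∃ ε : ℕ → ℝ, Tendsto ε atTop (𝓝 0) ∧
        ∀ n : ℕ, ((((bridges d (u (φ n))).filter fun ω =>
            v * (u (φ n) : ℝ) ≤ ((ω (u (φ n)) 0 : ℤ) : ℝ)).card : ℝ)) ≤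
          Real.exp (ε n * (u (φ n) : ℝ)) *
            (((((bridges d (u (φ n))).filter fun ω =>
                v * (u (φ n) : ℝ) ≤ ((ω (u (φ n)) 0 : ℤ) : ℝ)).filter fun ω =>
                δ * (u (φ n) : ℝ) ≤ (renewalCount (u (φ n)) ω : ℝ)).card : ℝ)))
    (hK3 : ∀ δ : ℝ, 0 < δ → ∃ ε : ℝ, 0 < ε ∧ ∀ᶠ n : ℕ in atTop,
      ((((bridges d n).filter fun ω => δ * (n : ℝ) ≤ (renewalCount n ω : ℝ)).card : ℝ) ≤
        Real.exp (-(ε * (n : ℝ))) * ((bridges d n).card : ℝ))) :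
    ∀ v : ℝ, 0 < v → ∃ c : ℝ, 0 < c ∧ ∃ n₀ : ℕ, ∀ n : ℕ, n₀ ≤ n →
      ((((bridges d n).filter fun ω => v * (n : ℝ) ≤ ((ω n 0 : ℤ) : ℝ)).card : ℝ)) ≤
        Real.exp (-(c * n)) * (bridgeCount d n : ℝ) := by
  classical
  intro v hv
  by_contra hneg
  obtain ⟨u, hu, hu1, hball⟩ := exists_strictMono_ballistic_of_not hneg
  obtain ⟨δ, hδ, φ, hφ, ε, hε, h31b⟩ := h31 v hv u hu
  obtain ⟨ε₀, hε₀, hK⟩ := hK3 δ hδ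
  obtain ⟨M₀, hM₀⟩ := eventually_atTop.1 hK
  -- choose `n` large: `u (φ n) ≥ M₀`, `ε n < ε₀ / 2`, `1/(φ n + 1) ≤ ε₀ / 2`
  have hφge : ∀ n, n ≤ φ n := fun n => hφ.id_le n
  have huge : ∀ n, n ≤ u n := fun n => hu.id_le n
  have e1 : ∀ᶠ n : ℕ in atTop, ε n < ε₀ / 2 := by
    have := (Metric.tendsto_nhds.1 hε) (ε₀ / 2) (by positivity)
    filter_upwards [this] with n hn
    rw [Real.dist_eq, sub_zero] at hn
    exact (abs_lt.1 hn).2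
  have e2 : ∀ᶠ n : ℕ in atTop, 1 / ((n : ℝ) + 1) ≤ ε₀ / 2 := by
    have : Tendsto (fun n : ℕ => 1 / ((n : ℝ) + 1)) atTop (𝓝 0) := tendsto_one_div_add_atTop_nhds_zero_nat
    exact this.eventually_le_const (by positivity)
  have e3 : ∀ᶠ n : ℕ in atTop, M₀ ≤ n := eventually_ge_atTop M₀
  obtain ⟨n, hn1, hn2, hn3⟩ := (e1.and (e2.and e3)).exists
  obtain ⟨k, hk⟩ : ∃ k, k = φ n := ⟨_, rfl⟩
  obtain ⟨N, hN⟩ : ∃ N, N = u k := ⟨_, rfl⟩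
  have hNM : M₀ ≤ N := by rw [hN, hk]; exact (hn3.trans (hφge n)).trans (huge (φ n))
  have hN1 : 1 ≤ N := by rw [hN]; exact hu1 k
  have hNpos : (0 : ℝ) < N := by exact_mod_cast hN1
  have hb : (0 : ℝ) < bridgeCount d N := by exact_mod_cast one_le_bridgeCount (d := d) N
  -- the three inequalities at `N`
  have i1 := hball k
  have i2 := h31b n
  have i3 := hM₀ N hNM
  rw [← hN] at i1
  rw [← hk, ← hN] at i2
  -- `#{high ∧ many renewals} ≤ #{many renewals}`
  have i4 : (((((bridges d N).filter fun ω => v * (N : ℝ) ≤ ((ω N 0 : ℤ) : ℝ)).filter fun ω =>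
      δ * (N : ℝ) ≤ (renewalCount N ω : ℝ)).card : ℝ)) ≤
      ((((bridges d N).filter fun ω => δ * (N : ℝ) ≤ (renewalCount N ω : ℝ)).card : ℝ)) := by
    exact_mod_cast Finset.card_le_card (Finset.filter_subset_filter _ (Finset.filter_subset _ _))
  rw [bridgeCount] at i1 hb
  have hexp_n : 0 < Real.exp (ε n * N) := Real.exp_pos _
  -- chain: e^{-N/(k+1)} b_N < e^{ε_n N} e^{-ε₀ N} b_N
  have chain : Real.exp (-(1 / ((k : ℝ) + 1) * N)) * ((bridges d N).card : ℝ) <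
      Real.exp (ε n * N) * (Real.exp (-(ε₀ * N)) * ((bridges d N).card : ℝ)) := by
    calc Real.exp (-(1 / ((k : ℝ) + 1) * N)) * ((bridges d N).card : ℝ)
        < _ := i1
      _ ≤ _ := i2
      _ ≤ Real.exp (ε n * N) * ((((bridges d N).filter fun ω =>
            δ * (N : ℝ) ≤ (renewalCount N ω : ℝ)).card : ℝ)) := by gcongr
      _ ≤ Real.exp (ε n * N) * (Real.exp (-(ε₀ * N)) * ((bridges d N).card : ℝ)) := by gcongr
  rw [← mul_assoc, ← Real.exp_add] at chain
  have h2 := lt_of_mul_lt_mul_right chain hb.le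
  rw [Real.exp_lt_exp] at h2
  -- `-N/(k+1) < (ε n - ε₀) N` ⇒ `ε₀ < ε n + 1/(k+1)`
  have h3 : ε₀ < ε n + 1 / ((k : ℝ) + 1) := by
    have : (ε₀ - ε n - 1 / ((k : ℝ) + 1)) * N < 0 := by nlinarith
    have h4 : ε₀ - ε n - 1 / ((k : ℝ) + 1) < 0 := by
      by_contra h5
      have : 0 ≤ (ε₀ - ε n - 1 / ((k : ℝ) + 1)) * N := mul_nonneg (not_lt.1 h5) hNpos.le
      linarith
    linarith
  have hk1 : 1 / ((k : ℝ) + 1) ≤ 1 / ((n : ℝ) + 1) := by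
    apply one_div_le_one_div_of_le (by positivity)
    have : (n : ℝ) ≤ k := by rw [hk]; exact_mod_cast hφge n
    linarith
  linarith

end Literature.Probability.RandomPlanarGeometry.SAW.Zd

end
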